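import Literature.Barriers.CriticalPhenomena.WeaklySAWPerturbativeTransformation
import Literature.Barriers.CriticalPhenomena.WeaklySAWPerturbativeXi
import HarnessLib

/-!
# BBS 2015, §6.1 / [BBS-rg-pt, Proposition 4.2.1], quantitative part: `T_{j+1} ∘ φ_pt^{(0)} =
# φ̄_j ∘ T_j + O(ϑ_j‖V‖³)` and the inverse of `T_j` on a ball independent of `j` and `m²`

Sequel of `WeaklySAWPerturbativeTransformation.lean` (`T_j = Ttrans`, `φ_pt^{(0)} = phiPT`,
`ρ̃_j = rhoPT = T_{j+1} ∘ φ_pt^{(0)} - φ̄_j ∘ T_j` with its second-order cancellation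
`rhoPT_apply_zero/one/two`). Source: Bauerschmidt–Brydges–Slade, CMP 337 (2015) [BBS2015], §6.1:
"`T_0(V) = V`, `T_j(V) = V + O(‖V‖²)`, with error estimate uniform in `j`. Since the `T_j` are
polynomials, this implies that they are invertible in a neighbourhood of `0` that is independent of
`j`. The composite maps `T_{j+1} ∘ φ_{pt,j}^{(0)} ∘ T_j⁻¹` are equal, up to an error `O(‖V‖³)`, to
`φ̄_j`"; and [BBS-rg-pt] (arXiv:1403.7252), Proposition 4.2.1: "There exist an open ball `B ⊂ ℝ³`
centred at `0` (independent of `j ≥ 1` and `m² ∈ [0, m̄²]`), and … maps `ρ_{pt,j} : B → ℝ³` such that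
`T_{j+1} ∘ φ_{pt,j}^{(0)} = φ̄_j ∘ T_j + ρ_{pt,j} ∘ T_j`, `T_j(V) = V + O(|V|²)`, the inverse `T_j⁻¹`
to `T_j` exists on `B` … with `T_j⁻¹(V) = V + O(|V|²)`, and `ρ_{pt,j}(V) = O((1+m²L^{2j})^{-k}|V|³)`.
All constants are uniform in `j ≥ 1` and `m² ∈ [0, m̄²]`", with its proof in §6.2 ("By the inverse
function theorem … `ε` can be chosen uniformly in `j` and `m²` by the uniformity of the bounds on
`w̄_j^{(1)}` and `w̄_j^{(**)}` … it follows from Lemma 6.1.2 that … `= ǧ_pt + O((1+m²L^{2j})^{-k}|V|³)`").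

## What this file proves (no definition, no named fact; `d = 4`, `L ≥ 2`, every `m² ≥ 0`)

* elementary `|·|`-calculus (`abs_add_le_of_le`, `abs_sub_le_of_le`, `abs_mul_le_of_le`,
  `abs_neg_le_of_le`, `abs_sq_le_mul`) and the size of the building blocks: `abs_muPlus_le(_mul)`,
  `abs_phiPT_two_le` (`μ_pt = O(|V|)`), `abs_Ttrans_one_le`, `abs_Ttrans_two_le`;
* the three rows `abs_rhoPT_zero_le`, `abs_rhoPT_one_le`, `abs_rhoPT_two_le`: under `|g|,|z|,|μ| ≤
  t ≤ 1`, `|w̄| ≤ W` and `|β_j|,|θ_j|,|η_j|,|ξ_j|,|ω_j|,|π_j|,|L^{-2j}C_{j+1}^{(1)}|,|L^{-4j}C_{j+1}^{(**)}|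
  ≤ Gϑ`, each component of `ρ̃_j(V)` is `≤ P(W,G,L)·ϑ·t³` with an explicit polynomial `P` (the
  termwise triangle inequality applied to the cubic normal forms of the previous file);
  `exists_norm_rhoPT_le_of_bounds` (the three together, sup norm);
* **`norm_rhoPT_le`** — for every `p` there is `C = C(p, L)` with
  `‖ρ̃_j(V)‖ ≤ Cϑ_j(m²;p)‖V‖³` for ALL `j ≥ 0`, ALL `m² ≥ 0` and `‖V‖ ≤ 1`, where
  `ϑ_j(m²;p) = ((1+L^{2j}m²/(8+m²))^p)⁻¹ ≤ 9^p(1+m²L^{2j})^{-p}` (`decayFactor_le_printed`): the printed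
  `ρ_pt = O((1+m²L^{2j})^{-k}|V|³)` before composing with `T_j⁻¹`;
* **`Ttrans_inverse`**, **`exists_Ttrans_inverse`** — `T_j` is invertible on the ball `‖U‖ ≤ r` with `r > 0`
  independent of `j` and `m² ≥ 0`: a unique `V` with `‖V‖ ≤ 2r`, `T_j(V) = U`, and
  `‖V - U‖ ≤ A‖U‖²` ("`T_j⁻¹(V) = V + O(|V|²)`"), by the contraction principle with the Lipschitz bound
  `norm_Ttrans_sub_sub_le` of the quadratic part;
* **`BBSrgpt_prop421`** — the assembled statement: for `‖U‖ ≤ r`, with `V = T_j⁻¹(U)`,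
  `T_{j+1}(φ_{pt,j}^{(0)}(V)) = φ̄_j(U) + ρ̃_j(V)` and `‖ρ̃_j(V)‖ ≤ Cϑ_j‖U‖³`.

Not here: analyticity of `T_j⁻¹` and of `ρ_pt` (they are a polynomial inverse and a polynomial).
-/

noncomputable section

open Set Filter Topology Metric
open Literature.Probability.LatticeModels
open scoped BigOperators NNReal

namespace Literature.Barriers.CriticalPhenomena

namespace CTWSAW

open LongRangePhi4 LongRangePhi4.FRD PT

/-! ### `|·|`-calculus -/

/-- `|a| ≤ A`, `|b| ≤ B` ⟹ `|a + b| ≤ A + B`. [folklore] -/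
theorem abs_add_le_of_le {a b A B : ℝ} (ha : |a| ≤ A) (hb : |b| ≤ B) : |a + b| ≤ A + B :=
  (abs_add_le a b).trans (add_le_add ha hb)

/-- `|a| ≤ A`, `|b| ≤ B` ⟹ `|a - b| ≤ A + B`. [folklore] -/
theorem abs_sub_le_of_le {a b A B : ℝ} (ha : |a| ≤ A) (hb : |b| ≤ B) : |a - b| ≤ A + B :=
  (abs_sub a b).trans (add_le_add ha hb)

/-- `|a| ≤ A`, `|b| ≤ B` ⟹ `|ab| ≤ AB`. [folklore] -/
theorem abs_mul_le_of_le {a b A B : ℝ} (ha : |a| ≤ A) (hb : |b| ≤ B) : |a * b| ≤ A * B := by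
  rw [abs_mul]; exact mul_le_mul ha hb (abs_nonneg _) ((abs_nonneg _).trans ha)

/-- `|a| ≤ A` ⟹ `|-a| ≤ A`. [folklore] -/
theorem abs_neg_le_of_le {a A : ℝ} (ha : |a| ≤ A) : |-a| ≤ A := by rwa [abs_neg]

/-- `|a| ≤ A`, `|a| ≤ B` ⟹ `|a²| ≤ AB`. [folklore] -/
theorem abs_sq_le_mul {a A B : ℝ} (ha : |a| ≤ A) (hb : |a| ≤ B) : |a ^ 2| ≤ A * B := by
  rw [sq]; exact abs_mul_le_of_le ha hb

/-! ### Sizes of the building blocks, and the three rows (generated termwise estimates) -/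

/-- `|μ₊| ≤ (L² + G)t` for `|μ| , |g| ≤ t`, `|η_j| ≤ G`. [cite: BauerschmidtBrydgesSlade2015LogCorr, §6.1 ([BBS-rg-pt] §6.2, proof of Proposition 4.2.1)] -/
theorem abs_muPlus_le_mul {L s : ℝ} {j : ℕ} {V : V3} {t G : ℝ} 
    (hg : |V 0| ≤ t)
    (hm : |V 2| ≤ t)
    (he1 : |etaPT 4 L s j| ≤ G) :
    |muPlus L s j V| ≤ ((L ^ 2) + G) * t := by
  have hL2 : |L ^ 2| ≤ L ^ 2 := (abs_of_nonneg (by positivity)).le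
  rw [muPlus]
  exact (abs_add_le_of_le (abs_mul_le_of_le (hL2) (hm)) (abs_mul_le_of_le (he1) (hg))).trans
      (le_of_eq (by ring))

/-- `|μ₊| ≤ L² + G` for `|μ|, |g| ≤ 1`, `|η_j| ≤ G`. [cite: BauerschmidtBrydgesSlade2015LogCorr, §6.1 ([BBS-rg-pt] §6.2, proof of Proposition 4.2.1)] -/
theorem abs_muPlus_le {L s : ℝ} {j : ℕ} {V : V3} {G : ℝ} 
    (hg1 : |V 0| ≤ 1)
    (hm1 : |V 2| ≤ 1)
    (he1 : |etaPT 4 L s j| ≤ G) :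
    |muPlus L s j V| ≤ (L ^ 2) + G := by
  have hL2 : |L ^ 2| ≤ L ^ 2 := (abs_of_nonneg (by positivity)).le
  rw [muPlus]
  exact (abs_add_le_of_le (abs_mul_le_of_le (hL2) (hm1)) (abs_mul_le_of_le (he1) (hg1))).trans
      (le_of_eq (by ring))

/-- `μ_pt = O(|V|)`: `|μ_pt| ≤ M(W,G,L)·t` when `|g|, |z|, |μ| ≤ t ≤ 1`, the `w̄`'s are bounded by `W` and the coefficients by `G`. [cite: BauerschmidtBrydgesSlade2015LogCorr, §6.1 ([BBS-rg-pt] §6.2, proof of Proposition 4.2.1)] -/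
theorem abs_phiPT_two_le {L s : ℝ} {j : ℕ} {V : V3} {t W G : ℝ} 
    (hg : |V 0| ≤ t)
    (hg1 : |V 0| ≤ 1)
    (hz1 : |V 1| ≤ 1)
    (hm : |V 2| ≤ t)
    (hm1 : |V 2| ≤ 1)
    (hw0 : |wbarOne 4 L s j| ≤ W)
    (hw1 : |wbarOne 4 L s (j + 1)| ≤ W)
    (he1 : |etaPT 4 L s j| ≤ G)
    (hx1 : |xiPT 4 L s j| ≤ G)
    (ho1 : |omegaPT 4 L s j| ≤ G)
    (hp1 : |piPT 4 L s j| ≤ G)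
    (hmp : |muPlus L s j V| ≤ ((L ^ 2) + G) * t)
    (hmp1 : |muPlus L s j V| ≤ (L ^ 2) + G) :
    |phiPT L s j V 2| ≤ ((L ^ 2) + 4 * G + W * (L ^ 2) + W * (L ^ 2) ^ 2 + 4 * W * G + 2 * W * G *
        (L ^ 2) + W * G ^ 2) * t := by
  have hL2 : |L ^ 2| ≤ L ^ 2 := (abs_of_nonneg (by positivity)).le
  have h4 : |(4 : ℝ)| ≤ 4 := by norm_num
  rw [phiPT_apply_two]
  exact (abs_sub_le_of_le (abs_sub_le_of_le (abs_sub_le_of_le (abs_sub_le_of_le (abs_add_le_of_le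
      (abs_mul_le_of_le (hL2) (hm)) (abs_mul_le_of_le (he1) (abs_add_le_of_le (hg) (abs_mul_le_of_le
      (abs_mul_le_of_le (abs_mul_le_of_le (h4) (hg)) (hm1)) (hw0))))) (abs_mul_le_of_le (hx1)
      (abs_sq_le_mul hg hg1))) (abs_mul_le_of_le (abs_mul_le_of_le (ho1) (hg)) (hm1)))
      (abs_mul_le_of_le (abs_mul_le_of_le (hp1) (hg)) (hz1))) (abs_sub_le_of_le (abs_mul_le_of_le
      (abs_sq_le_mul hmp hmp1) (hw1)) (abs_mul_le_of_le (abs_mul_le_of_le (hL2) (abs_sq_le_mul hm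
      hm1)) (hw0)))).trans (le_of_eq (by ring))

/-- `|μ̌| ≤ (1 + W)t`. [cite: BauerschmidtBrydgesSlade2015LogCorr, §6.1 (T_j(V) = V + O(‖V‖²))] -/
theorem abs_Ttrans_two_le {L s : ℝ} {j : ℕ} {V : V3} {t W : ℝ} 
    (hm : |V 2| ≤ t)
    (hm1 : |V 2| ≤ 1)
    (hw0 : |wbarOne 4 L s j| ≤ W) :
    |Ttrans L s j V 2| ≤ (1 + W) * t := by
  rw [Ttrans_apply_two]
  exact (abs_add_le_of_le (hm) (abs_mul_le_of_le (abs_sq_le_mul hm hm1) (hw0))).trans (le_of_eq (by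
      ring))

/-- `|ž| ≤ (1 + (5/2)W)t`. [cite: BauerschmidtBrydgesSlade2015LogCorr, §6.1 (T_j(V) = V + O(‖V‖²))] -/
theorem abs_Ttrans_one_le {L s : ℝ} {j : ℕ} {V : V3} {t W : ℝ} 
    (hz : |V 1| ≤ t)
    (hm : |V 2| ≤ t)
    (hm1 : |V 2| ≤ 1)
    (hw0 : |wbarOne 4 L s j| ≤ W)
    (hs0 : |wbarStar 4 L s j| ≤ W) :
    |Ttrans L s j V 1| ≤ (1 + 5 / 2 * W) * t := by
  have h2 : |(2 : ℝ)| ≤ 2 := by norm_num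
  have hhalf : |(1 / 2 : ℝ)| ≤ 1 / 2 := by norm_num
  rw [Ttrans_apply_one]
  exact (abs_add_le_of_le (abs_add_le_of_le (hz) (abs_mul_le_of_le (abs_mul_le_of_le
      (abs_mul_le_of_le (h2) (hz)) (hm1)) (hw0))) (abs_mul_le_of_le (abs_mul_le_of_le (hhalf)
      (abs_sq_le_mul hm hm1)) (hs0))).trans (le_of_eq (by ring))

/-- **The `g`-row of `ρ̃_j` is `O(ϑ_j|V|³)`**, explicit: under the bounds listed (`|g|,|z|,|μ| ≤ t ≤ 1`; `|w̄| ≤ W`; decaying quantities `≤ Gϑ`), `|ρ̃_j(V)_g| ≤ P₀(W,G,L)·ϑ·t³`. [cite: BauerschmidtBrydgesSlade2015LogCorr, §6.1 ("equal, up to an error O(‖V‖³), to φ̄_j"; [BBS-rg-pt] Proposition 4.2.1, ρ_pt = O((1+m²L^{2j})^{-k}|V|³))] -/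
theorem abs_rhoPT_zero_le {L s : ℝ} {j : ℕ} {V : V3} {t ϑ W G : ℝ} 
    (hg : |V 0| ≤ t)
    (hz : |V 1| ≤ t)
    (hm : |V 2| ≤ t)
    (hm1 : |V 2| ≤ 1)
    (hw0 : |wbarOne 4 L s j| ≤ W)
    (hw1 : |wbarOne 4 L s (j + 1)| ≤ W)
    (hb : |betaPT 4 L s j| ≤ G * ϑ)
    (he : |etaPT 4 L s j| ≤ G * ϑ)
    (he1 : |etaPT 4 L s j| ≤ G)
    (hx : |xiPT 4 L s j| ≤ G * ϑ)
    (ho : |omegaPT 4 L s j| ≤ G * ϑ)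
    (hp : |piPT 4 L s j| ≤ G * ϑ)
    (hD1 : |wbarOneDiff 4 L s j| ≤ G * ϑ)
    (hmpt : |phiPT L s j V 2| ≤ ((L ^ 2) + 4 * G + W * (L ^ 2) + W * (L ^ 2) ^ 2 + 4 * W * G + 2 * W
        * G * (L ^ 2) + W * G ^ 2) * t) :
    |rhoPT L s j V 0| ≤
      (20 * W * G + 24 * W * G * (L ^ 2) + 80 * W * G ^ 2 + 32 * W ^ 2 * G + 44 * W ^ 2 * G * (L ^
          2) + 20 * W ^ 2 * G * (L ^ 2) ^ 2 + 148 * W ^ 2 * G ^ 2 + 40 * W ^ 2 * G ^ 2 * (L ^ 2) +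
          20 * W ^ 2 * G ^ 3 + 16 * W ^ 3 * G * (L ^ 2) + 16 * W ^ 3 * G * (L ^ 2) ^ 2 + 64 * W ^ 3
          * G ^ 2 + 32 * W ^ 3 * G ^ 2 * (L ^ 2) + 16 * W ^ 3 * G ^ 3) * ϑ * t ^ 3 := by
  have hL2 : |L ^ 2| ≤ L ^ 2 := (abs_of_nonneg (by positivity)).le
  have h4 : |(4 : ℝ)| ≤ 4 := by norm_num
  have h2 : |(2 : ℝ)| ≤ 2 := by norm_num
  have e : rhoPT L s j V 0 =
      (betaPT 4 L s j) * ((4 * V 0 * V 2 * wbarOne 4 L s j) * (2 * V 0 + 4 * V 0 * V 2 * wbarOne 4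
        L s j)) + (4 * wbarOne 4 L s (j + 1)) * ((-(betaPT 4 L s j * V 0 ^ 2 + (4 * V 0) * (V 2 *
        wbarOneDiff 4 L s j + etaPT 4 L s j * V 0 * wbarOne 4 L s (j + 1)))) * phiPT L s j V 2 + (V
        0) * (-(L ^ 2 * V 2 ^ 2 * wbarOneDiff 4 L s j) - (etaPT 4 L s j) * (2 * L ^ 2 * V 0 * V 2 +
        etaPT 4 L s j * V 0 ^ 2) * wbarOne 4 L s (j + 1) + (4 * etaPT 4 L s j * V 0 * V 2 * wbarOne
        4 L s j - xiPT 4 L s j * V 0 ^ 2 - omegaPT 4 L s j * V 0 * V 2 - piPT 4 L s j * V 0 * V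
        1))) :=
    (rhoPT_apply_zero L s j V).trans (by ring)
  rw [e]
  exact (abs_add_le_of_le (abs_mul_le_of_le (hb) (abs_mul_le_of_le (abs_mul_le_of_le
      (abs_mul_le_of_le (abs_mul_le_of_le (h4) (hg)) (hm)) (hw0)) (abs_add_le_of_le
      (abs_mul_le_of_le (h2) (hg)) (abs_mul_le_of_le (abs_mul_le_of_le (abs_mul_le_of_le (h4) (hg))
      (hm1)) (hw0))))) (abs_mul_le_of_le (abs_mul_le_of_le (h4) (hw1)) (abs_add_le_of_le
      (abs_mul_le_of_le (abs_neg_le_of_le (abs_add_le_of_le (abs_mul_le_of_le (hb) (abs_sq_le_mul hg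
      hg)) (abs_mul_le_of_le (abs_mul_le_of_le (h4) (hg)) (abs_add_le_of_le (abs_mul_le_of_le (hm)
      (hD1)) (abs_mul_le_of_le (abs_mul_le_of_le (he) (hg)) (hw1)))))) (hmpt)) (abs_mul_le_of_le
      (hg) (abs_add_le_of_le (abs_sub_le_of_le (abs_neg_le_of_le (abs_mul_le_of_le (abs_mul_le_of_le
      (hL2) (abs_sq_le_mul hm hm)) (hD1))) (abs_mul_le_of_le (abs_mul_le_of_le (he)
      (abs_add_le_of_le (abs_mul_le_of_le (abs_mul_le_of_le (abs_mul_le_of_le (h2) (hL2)) (hg))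
      (hm)) (abs_mul_le_of_le (he1) (abs_sq_le_mul hg hg)))) (hw1))) (abs_sub_le_of_le
      (abs_sub_le_of_le (abs_sub_le_of_le (abs_mul_le_of_le (abs_mul_le_of_le (abs_mul_le_of_le
      (abs_mul_le_of_le (h4) (he)) (hg)) (hm)) (hw0)) (abs_mul_le_of_le (hx) (abs_sq_le_mul hg hg)))
      (abs_mul_le_of_le (abs_mul_le_of_le (ho) (hg)) (hm))) (abs_mul_le_of_le (abs_mul_le_of_le (hp)
      (hg)) (hz)))))))).trans
    (le_of_eq (by ring))

/-- **The `z`-row of `ρ̃_j` is `O(ϑ_j|V|³)`**, explicit. [cite: BauerschmidtBrydgesSlade2015LogCorr, §6.1; [BBS-rg-pt] Proposition 4.2.1] -/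
theorem abs_rhoPT_one_le {L s : ℝ} {j : ℕ} {V : V3} {t ϑ W G : ℝ} 
    (hg : |V 0| ≤ t)
    (hz : |V 1| ≤ t)
    (hm : |V 2| ≤ t)
    (hm1 : |V 2| ≤ 1)
    (hw0 : |wbarOne 4 L s j| ≤ W)
    (hw1 : |wbarOne 4 L s (j + 1)| ≤ W)
    (hs1 : |wbarStar 4 L s (j + 1)| ≤ W)
    (hth : |thetaPT 4 L s j| ≤ G * ϑ)
    (he : |etaPT 4 L s j| ≤ G * ϑ)
    (he1 : |etaPT 4 L s j| ≤ G)
    (hx : |xiPT 4 L s j| ≤ G * ϑ)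
    (ho : |omegaPT 4 L s j| ≤ G * ϑ)
    (hp : |piPT 4 L s j| ≤ G * ϑ)
    (hD1 : |wbarOneDiff 4 L s j| ≤ G * ϑ)
    (hD2 : |wbarStarDiff 4 L s j| ≤ G * ϑ)
    (hmp : |muPlus L s j V| ≤ ((L ^ 2) + G) * t)
    (hmpt : |phiPT L s j V 2| ≤ ((L ^ 2) + 4 * G + W * (L ^ 2) + W * (L ^ 2) ^ 2 + 4 * W * G + 2 * W
        * G * (L ^ 2) + W * G ^ 2) * t) :
    |rhoPT L s j V 1| ≤
      (14 * W * G + 12 * W * G * (L ^ 2) + W * G * (L ^ 2) ^ 2 + 71 / 2 * W * G ^ 2 + 5 / 2 * W * G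
          ^ 2 * (L ^ 2) + 24 * W ^ 2 * G + 41 / 2 * W ^ 2 * G * (L ^ 2) + 13 * W ^ 2 * G * (L ^ 2) ^
          2 + 1 / 2 * W ^ 2 * G * (L ^ 2) ^ 3 + 62 * W ^ 2 * G ^ 2 + 34 * W ^ 2 * G ^ 2 * (L ^ 2) +
          W ^ 2 * G ^ 2 * (L ^ 2) ^ 2 + 15 * W ^ 2 * G ^ 3 + 1 / 2 * W ^ 2 * G ^ 3 * (L ^ 2) + 6 * W
          ^ 3 * G * (L ^ 2) + 9 * W ^ 3 * G * (L ^ 2) ^ 2 + 3 * W ^ 3 * G * (L ^ 2) ^ 3 + 24 * W ^ 3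
          * G ^ 2 + 51 / 2 * W ^ 3 * G ^ 2 * (L ^ 2) + 15 / 2 * W ^ 3 * G ^ 2 * (L ^ 2) ^ 2 + 12 * W
          ^ 3 * G ^ 3 + 6 * W ^ 3 * G ^ 3 * (L ^ 2) + 3 / 2 * W ^ 3 * G ^ 4) * ϑ * t ^ 3 := by
  have hL2 : |L ^ 2| ≤ L ^ 2 := (abs_of_nonneg (by positivity)).le
  have h4 : |(4 : ℝ)| ≤ 4 := by norm_num
  have h2 : |(2 : ℝ)| ≤ 2 := by norm_num
  have hhalf : |(1 / 2 : ℝ)| ≤ 1 / 2 := by norm_num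
  have e : rhoPT L s j V 1 =
      (thetaPT 4 L s j) * ((4 * V 0 * V 2 * wbarOne 4 L s j) * (2 * V 0 + 4 * V 0 * V 2 * wbarOne 4
        L s j)) + (2 * wbarOne 4 L s (j + 1)) * ((-((2 * V 1) * (V 2 * wbarOneDiff 4 L s j + etaPT
        4 L s j * V 0 * wbarOne 4 L s (j + 1)) + (1 / 2) * (V 2 ^ 2 * wbarStarDiff 4 L s j + (etaPT
        4 L s j) * (2 * L ^ 2 * V 0 * V 2 + etaPT 4 L s j * V 0 ^ 2) * wbarStar 4 L s (j + 1)) +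
        thetaPT 4 L s j * V 0 ^ 2)) * phiPT L s j V 2 + (V 1) * (-(L ^ 2 * V 2 ^ 2 * wbarOneDiff 4
        L s j) - (etaPT 4 L s j) * (2 * L ^ 2 * V 0 * V 2 + etaPT 4 L s j * V 0 ^ 2) * wbarOne 4 L
        s (j + 1) + (4 * etaPT 4 L s j * V 0 * V 2 * wbarOne 4 L s j - xiPT 4 L s j * V 0 ^ 2 -
        omegaPT 4 L s j * V 0 * V 2 - piPT 4 L s j * V 0 * V 1))) + (1 / 2 * wbarStar 4 L s (j +
        1)) * ((-(L ^ 2 * V 2 ^ 2 * wbarOneDiff 4 L s j) - (etaPT 4 L s j) * (2 * L ^ 2 * V 0 * V 2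
        + etaPT 4 L s j * V 0 ^ 2) * wbarOne 4 L s (j + 1) + (4 * etaPT 4 L s j * V 0 * V 2 *
        wbarOne 4 L s j - xiPT 4 L s j * V 0 ^ 2 - omegaPT 4 L s j * V 0 * V 2 - piPT 4 L s j * V 0
        * V 1)) * (phiPT L s j V 2 + muPlus L s j V)) :=
    (rhoPT_apply_one L s j V).trans (by ring)
  rw [e]
  exact (abs_add_le_of_le (abs_add_le_of_le (abs_mul_le_of_le (hth) (abs_mul_le_of_le
      (abs_mul_le_of_le (abs_mul_le_of_le (abs_mul_le_of_le (h4) (hg)) (hm)) (hw0))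
      (abs_add_le_of_le (abs_mul_le_of_le (h2) (hg)) (abs_mul_le_of_le (abs_mul_le_of_le
      (abs_mul_le_of_le (h4) (hg)) (hm1)) (hw0))))) (abs_mul_le_of_le (abs_mul_le_of_le (h2) (hw1))
      (abs_add_le_of_le (abs_mul_le_of_le (abs_neg_le_of_le (abs_add_le_of_le (abs_add_le_of_le
      (abs_mul_le_of_le (abs_mul_le_of_le (h2) (hz)) (abs_add_le_of_le (abs_mul_le_of_le (hm) (hD1))
      (abs_mul_le_of_le (abs_mul_le_of_le (he) (hg)) (hw1)))) (abs_mul_le_of_le (hhalf)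
      (abs_add_le_of_le (abs_mul_le_of_le (abs_sq_le_mul hm hm) (hD2)) (abs_mul_le_of_le
      (abs_mul_le_of_le (he) (abs_add_le_of_le (abs_mul_le_of_le (abs_mul_le_of_le (abs_mul_le_of_le
      (h2) (hL2)) (hg)) (hm)) (abs_mul_le_of_le (he1) (abs_sq_le_mul hg hg)))) (hs1)))))
      (abs_mul_le_of_le (hth) (abs_sq_le_mul hg hg)))) (hmpt)) (abs_mul_le_of_le (hz)
      (abs_add_le_of_le (abs_sub_le_of_le (abs_neg_le_of_le (abs_mul_le_of_le (abs_mul_le_of_le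
      (hL2) (abs_sq_le_mul hm hm)) (hD1))) (abs_mul_le_of_le (abs_mul_le_of_le (he)
      (abs_add_le_of_le (abs_mul_le_of_le (abs_mul_le_of_le (abs_mul_le_of_le (h2) (hL2)) (hg))
      (hm)) (abs_mul_le_of_le (he1) (abs_sq_le_mul hg hg)))) (hw1))) (abs_sub_le_of_le
      (abs_sub_le_of_le (abs_sub_le_of_le (abs_mul_le_of_le (abs_mul_le_of_le (abs_mul_le_of_le
      (abs_mul_le_of_le (h4) (he)) (hg)) (hm)) (hw0)) (abs_mul_le_of_le (hx) (abs_sq_le_mul hg hg)))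
      (abs_mul_le_of_le (abs_mul_le_of_le (ho) (hg)) (hm))) (abs_mul_le_of_le (abs_mul_le_of_le (hp)
      (hg)) (hz)))))))) (abs_mul_le_of_le (abs_mul_le_of_le (hhalf) (hs1)) (abs_mul_le_of_le
      (abs_add_le_of_le (abs_sub_le_of_le (abs_neg_le_of_le (abs_mul_le_of_le (abs_mul_le_of_le
      (hL2) (abs_sq_le_mul hm hm)) (hD1))) (abs_mul_le_of_le (abs_mul_le_of_le (he)
      (abs_add_le_of_le (abs_mul_le_of_le (abs_mul_le_of_le (abs_mul_le_of_le (h2) (hL2)) (hg))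
      (hm)) (abs_mul_le_of_le (he1) (abs_sq_le_mul hg hg)))) (hw1))) (abs_sub_le_of_le
      (abs_sub_le_of_le (abs_sub_le_of_le (abs_mul_le_of_le (abs_mul_le_of_le (abs_mul_le_of_le
      (abs_mul_le_of_le (h4) (he)) (hg)) (hm)) (hw0)) (abs_mul_le_of_le (hx) (abs_sq_le_mul hg hg)))
      (abs_mul_le_of_le (abs_mul_le_of_le (ho) (hg)) (hm))) (abs_mul_le_of_le (abs_mul_le_of_le (hp)
      (hg)) (hz)))) (abs_add_le_of_le (hmpt) (hmp))))).trans
    (le_of_eq (by ring))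

/-- **The `μ`-row of `ρ̃_j` is `O(ϑ_j|V|³)`**, explicit. [cite: BauerschmidtBrydgesSlade2015LogCorr, §6.1; [BBS-rg-pt] Proposition 4.2.1] -/
theorem abs_rhoPT_two_le {L s : ℝ} {j : ℕ} {V : V3} {t ϑ W G : ℝ} 
    (hg : |V 0| ≤ t)
    (hz : |V 1| ≤ t)
    (hm : |V 2| ≤ t)
    (hm1 : |V 2| ≤ 1)
    (hw0 : |wbarOne 4 L s j| ≤ W)
    (hw1 : |wbarOne 4 L s (j + 1)| ≤ W)
    (hs0 : |wbarStar 4 L s j| ≤ W)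
    (he : |etaPT 4 L s j| ≤ G * ϑ)
    (he1 : |etaPT 4 L s j| ≤ G)
    (hx : |xiPT 4 L s j| ≤ G * ϑ)
    (ho : |omegaPT 4 L s j| ≤ G * ϑ)
    (hp : |piPT 4 L s j| ≤ G * ϑ)
    (hD1 : |wbarOneDiff 4 L s j| ≤ G * ϑ)
    (hmp : |muPlus L s j V| ≤ ((L ^ 2) + G) * t)
    (hmpt : |phiPT L s j V 2| ≤ ((L ^ 2) + 4 * G + W * (L ^ 2) + W * (L ^ 2) ^ 2 + 4 * W * G + 2 * W
        * G * (L ^ 2) + W * G ^ 2) * t)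
    (hmc : |Ttrans L s j V 2| ≤ (1 + W) * t)
    (hzc : |Ttrans L s j V 1| ≤ (1 + 5 / 2 * W) * t) :
    |rhoPT L s j V 2| ≤
      (39 / 2 * W * G + 6 * W * G * (L ^ 2) + 2 * W * G * (L ^ 2) ^ 2 + 15 * W * G ^ 2 + 5 * W * G ^
          2 * (L ^ 2) + 30 * W ^ 2 * G + 11 * W ^ 2 * G * (L ^ 2) + 8 * W ^ 2 * G * (L ^ 2) ^ 2 + W
          ^ 2 * G * (L ^ 2) ^ 3 + 32 * W ^ 2 * G ^ 2 + 22 * W ^ 2 * G ^ 2 * (L ^ 2) + 2 * W ^ 2 * G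
          ^ 2 * (L ^ 2) ^ 2 + 8 * W ^ 2 * G ^ 3 + W ^ 2 * G ^ 3 * (L ^ 2) + 4 * W ^ 3 * G * (L ^ 2)
          + 6 * W ^ 3 * G * (L ^ 2) ^ 2 + 2 * W ^ 3 * G * (L ^ 2) ^ 3 + 16 * W ^ 3 * G ^ 2 + 17 * W
          ^ 3 * G ^ 2 * (L ^ 2) + 5 * W ^ 3 * G ^ 2 * (L ^ 2) ^ 2 + 8 * W ^ 3 * G ^ 3 + 4 * W ^ 3 *
          G ^ 3 * (L ^ 2) + W ^ 3 * G ^ 4) * ϑ * t ^ 3 := by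
  have hL2 : |L ^ 2| ≤ L ^ 2 := (abs_of_nonneg (by positivity)).le
  have h4 : |(4 : ℝ)| ≤ 4 := by norm_num
  have h2 : |(2 : ℝ)| ≤ 2 := by norm_num
  have hhalf : |(1 / 2 : ℝ)| ≤ 1 / 2 := by norm_num
  have e : rhoPT L s j V 2 =
      (wbarOne 4 L s (j + 1)) * ((-(L ^ 2 * V 2 ^ 2 * wbarOneDiff 4 L s j) - (etaPT 4 L s j) * (2 *
        L ^ 2 * V 0 * V 2 + etaPT 4 L s j * V 0 ^ 2) * wbarOne 4 L s (j + 1) + (4 * etaPT 4 L s j *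
        V 0 * V 2 * wbarOne 4 L s j - xiPT 4 L s j * V 0 ^ 2 - omegaPT 4 L s j * V 0 * V 2 - piPT 4
        L s j * V 0 * V 1)) * (phiPT L s j V 2 + muPlus L s j V)) + (xiPT 4 L s j) * ((4 * V 0 * V
        2 * wbarOne 4 L s j) * (2 * V 0 + 4 * V 0 * V 2 * wbarOne 4 L s j)) + (omegaPT 4 L s j) *
        (4 * V 0 * V 2 * wbarOne 4 L s j * Ttrans L s j V 2 + (V 0) * (V 2 ^ 2 * wbarOne 4 L s j)) +
        (piPT 4 L s j) * (4 * V 0 * V 2 * wbarOne 4 L s j * Ttrans L s j V 1 + (V 0) * (2 * V 1 * V 2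
        * wbarOne 4 L s j + 1 / 2 * V 2 ^ 2 * wbarStar 4 L s j)) :=
    (rhoPT_apply_two L s j V).trans (by ring)
  rw [e]
  exact (abs_add_le_of_le (abs_add_le_of_le (abs_add_le_of_le (abs_mul_le_of_le (hw1)
      (abs_mul_le_of_le (abs_add_le_of_le (abs_sub_le_of_le (abs_neg_le_of_le (abs_mul_le_of_le
      (abs_mul_le_of_le (hL2) (abs_sq_le_mul hm hm)) (hD1))) (abs_mul_le_of_le (abs_mul_le_of_le
      (he) (abs_add_le_of_le (abs_mul_le_of_le (abs_mul_le_of_le (abs_mul_le_of_le (h2) (hL2)) (hg))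
      (hm)) (abs_mul_le_of_le (he1) (abs_sq_le_mul hg hg)))) (hw1))) (abs_sub_le_of_le
      (abs_sub_le_of_le (abs_sub_le_of_le (abs_mul_le_of_le (abs_mul_le_of_le (abs_mul_le_of_le
      (abs_mul_le_of_le (h4) (he)) (hg)) (hm)) (hw0)) (abs_mul_le_of_le (hx) (abs_sq_le_mul hg hg)))
      (abs_mul_le_of_le (abs_mul_le_of_le (ho) (hg)) (hm))) (abs_mul_le_of_le (abs_mul_le_of_le (hp)
      (hg)) (hz)))) (abs_add_le_of_le (hmpt) (hmp)))) (abs_mul_le_of_le (hx) (abs_mul_le_of_le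
      (abs_mul_le_of_le (abs_mul_le_of_le (abs_mul_le_of_le (h4) (hg)) (hm)) (hw0))
      (abs_add_le_of_le (abs_mul_le_of_le (h2) (hg)) (abs_mul_le_of_le (abs_mul_le_of_le
      (abs_mul_le_of_le (h4) (hg)) (hm1)) (hw0)))))) (abs_mul_le_of_le (ho) (abs_add_le_of_le
      (abs_mul_le_of_le (abs_mul_le_of_le (abs_mul_le_of_le (abs_mul_le_of_le (h4) (hg)) (hm))
      (hw0)) (hmc)) (abs_mul_le_of_le (hg) (abs_mul_le_of_le (abs_sq_le_mul hm hm) (hw0))))))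
      (abs_mul_le_of_le (hp) (abs_add_le_of_le (abs_mul_le_of_le (abs_mul_le_of_le (abs_mul_le_of_le
      (abs_mul_le_of_le (h4) (hg)) (hm)) (hw0)) (hzc)) (abs_mul_le_of_le (hg) (abs_add_le_of_le
      (abs_mul_le_of_le (abs_mul_le_of_le (abs_mul_le_of_le (h2) (hz)) (hm)) (hw0))
      (abs_mul_le_of_le (abs_mul_le_of_le (hhalf) (abs_sq_le_mul hm hm)) (hs0))))))).trans
    (le_of_eq (by ring))


/-! ### The three rows together -/

/-- **`ρ̃_j(V) = O(ϑ‖V‖³)` under the bounds of the rows**: there is `C = C(W,G,L) > 0` such that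
whenever `‖V‖ ≤ t ≤ 1`, `0 ≤ ϑ ≤ 1`, the four `w̄`'s are `≤ W` in absolute value and the eight
decaying quantities are `≤ Gϑ`, then `‖ρ̃_j(V)‖ ≤ Cϑt³` (sup norm on `ℝ³`).
[cite: BauerschmidtBrydgesSlade2015LogCorr, §6.1 ("equal, up to an error O(‖V‖³), to φ̄_j"); [BBS-rg-pt] Proposition 4.2.1 and §6.2] -/
theorem exists_norm_rhoPT_le_of_bounds (L : ℝ) {W G : ℝ} (hW : 0 ≤ W) (hG : 0 ≤ G) :
    ∃ C : ℝ, 0 < C ∧ ∀ (s : ℝ) (j : ℕ) (V : V3) (t ϑ : ℝ), ‖V‖ ≤ t → t ≤ 1 → 0 ≤ ϑ → ϑ ≤ 1 →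
      |wbarOne 4 L s j| ≤ W → |wbarOne 4 L s (j + 1)| ≤ W → |wbarStar 4 L s j| ≤ W →
      |wbarStar 4 L s (j + 1)| ≤ W → |betaPT 4 L s j| ≤ G * ϑ → |thetaPT 4 L s j| ≤ G * ϑ →
      |etaPT 4 L s j| ≤ G * ϑ → |xiPT 4 L s j| ≤ G * ϑ → |omegaPT 4 L s j| ≤ G * ϑ →
      |piPT 4 L s j| ≤ G * ϑ → |wbarOneDiff 4 L s j| ≤ G * ϑ → |wbarStarDiff 4 L s j| ≤ G * ϑ →
      ‖rhoPT L s j V‖ ≤ C * ϑ * t ^ 3 := by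
  have hc : ∀ (V : V3) (t : ℝ), ‖V‖ ≤ t → ∀ i, |V i| ≤ t := fun V t ht i =>
    le_trans (by rw [← Real.norm_eq_abs]; exact norm_le_pi_norm V i) ht
  have hGϑ : ∀ ϑ : ℝ, ϑ ≤ 1 → G * ϑ ≤ G := fun ϑ hϑ1 => mul_le_of_le_one_right hG hϑ1
  -- the three row constants, read off from the row lemmas by unification
  obtain ⟨P0, h0, hP0⟩ : ∃ P0 : ℝ, (∀ (s : ℝ) (j : ℕ) (V : V3) (t ϑ : ℝ), ‖V‖ ≤ t → t ≤ 1 → 0 ≤ ϑ →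
      ϑ ≤ 1 → |wbarOne 4 L s j| ≤ W → |wbarOne 4 L s (j + 1)| ≤ W → |wbarStar 4 L s j| ≤ W →
      |wbarStar 4 L s (j + 1)| ≤ W → |betaPT 4 L s j| ≤ G * ϑ → |thetaPT 4 L s j| ≤ G * ϑ →
      |etaPT 4 L s j| ≤ G * ϑ → |xiPT 4 L s j| ≤ G * ϑ → |omegaPT 4 L s j| ≤ G * ϑ →
      |piPT 4 L s j| ≤ G * ϑ → |wbarOneDiff 4 L s j| ≤ G * ϑ → |wbarStarDiff 4 L s j| ≤ G * ϑ →
      |rhoPT L s j V 0| ≤ P0 * ϑ * t ^ 3) ∧ 0 ≤ P0 := by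
    refine ⟨?_, fun s j V t ϑ ht ht1 _ hϑ1 hw0 hw1 _ _ hb _ he hx ho hp hD1 _ => ?_, ?_⟩
    rotate_left
    · have hg : |V 0| ≤ t := hc V t ht 0
      have hz : |V 1| ≤ t := hc V t ht 1
      have hm : |V 2| ≤ t := hc V t ht 2
      have hg1 : |V 0| ≤ 1 := hg.trans ht1
      have hz1 : |V 1| ≤ 1 := hz.trans ht1
      have hm1 : |V 2| ≤ 1 := hm.trans ht1
      have he1 := he.trans (hGϑ ϑ hϑ1)
      have hx1 := hx.trans (hGϑ ϑ hϑ1)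
      have ho1 := ho.trans (hGϑ ϑ hϑ1)
      have hp1 := hp.trans (hGϑ ϑ hϑ1)
      have hmp := abs_muPlus_le_mul hg hm he1
      have hmp1 := abs_muPlus_le hg1 hm1 he1
      have hmpt := abs_phiPT_two_le hg hg1 hz1 hm hm1 hw0 hw1 he1 hx1 ho1 hp1 hmp hmp1
      exact abs_rhoPT_zero_le hg hz hm hm1 hw0 hw1 hb he he1 hx ho hp hD1 hmpt
    · positivity
  obtain ⟨P1, h1, hP1⟩ : ∃ P1 : ℝ, (∀ (s : ℝ) (j : ℕ) (V : V3) (t ϑ : ℝ), ‖V‖ ≤ t → t ≤ 1 → 0 ≤ ϑ →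
      ϑ ≤ 1 → |wbarOne 4 L s j| ≤ W → |wbarOne 4 L s (j + 1)| ≤ W → |wbarStar 4 L s j| ≤ W →
      |wbarStar 4 L s (j + 1)| ≤ W → |betaPT 4 L s j| ≤ G * ϑ → |thetaPT 4 L s j| ≤ G * ϑ →
      |etaPT 4 L s j| ≤ G * ϑ → |xiPT 4 L s j| ≤ G * ϑ → |omegaPT 4 L s j| ≤ G * ϑ →
      |piPT 4 L s j| ≤ G * ϑ → |wbarOneDiff 4 L s j| ≤ G * ϑ → |wbarStarDiff 4 L s j| ≤ G * ϑ →
      |rhoPT L s j V 1| ≤ P1 * ϑ * t ^ 3) ∧ 0 ≤ P1 := by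
    refine ⟨?_, fun s j V t ϑ ht ht1 _ hϑ1 hw0 hw1 _ hs1 _ hth he hx ho hp hD1 hD2 => ?_, ?_⟩
    rotate_left
    · have hg : |V 0| ≤ t := hc V t ht 0
      have hz : |V 1| ≤ t := hc V t ht 1
      have hm : |V 2| ≤ t := hc V t ht 2
      have hg1 : |V 0| ≤ 1 := hg.trans ht1
      have hz1 : |V 1| ≤ 1 := hz.trans ht1
      have hm1 : |V 2| ≤ 1 := hm.trans ht1
      have he1 := he.trans (hGϑ ϑ hϑ1)
      have hx1 := hx.trans (hGϑ ϑ hϑ1)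
      have ho1 := ho.trans (hGϑ ϑ hϑ1)
      have hp1 := hp.trans (hGϑ ϑ hϑ1)
      have hmp := abs_muPlus_le_mul hg hm he1
      have hmp1 := abs_muPlus_le hg1 hm1 he1
      have hmpt := abs_phiPT_two_le hg hg1 hz1 hm hm1 hw0 hw1 he1 hx1 ho1 hp1 hmp hmp1
      exact abs_rhoPT_one_le hg hz hm hm1 hw0 hw1 hs1 hth he he1 hx ho hp hD1 hD2 hmp hmpt
    · positivity
  obtain ⟨P2, h2, hP2⟩ : ∃ P2 : ℝ, (∀ (s : ℝ) (j : ℕ) (V : V3) (t ϑ : ℝ), ‖V‖ ≤ t → t ≤ 1 → 0 ≤ ϑ →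
      ϑ ≤ 1 → |wbarOne 4 L s j| ≤ W → |wbarOne 4 L s (j + 1)| ≤ W → |wbarStar 4 L s j| ≤ W →
      |wbarStar 4 L s (j + 1)| ≤ W → |betaPT 4 L s j| ≤ G * ϑ → |thetaPT 4 L s j| ≤ G * ϑ →
      |etaPT 4 L s j| ≤ G * ϑ → |xiPT 4 L s j| ≤ G * ϑ → |omegaPT 4 L s j| ≤ G * ϑ →
      |piPT 4 L s j| ≤ G * ϑ → |wbarOneDiff 4 L s j| ≤ G * ϑ → |wbarStarDiff 4 L s j| ≤ G * ϑ →
      |rhoPT L s j V 2| ≤ P2 * ϑ * t ^ 3) ∧ 0 ≤ P2 := by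
    refine ⟨?_, fun s j V t ϑ ht ht1 _ hϑ1 hw0 hw1 hs0 _ _ _ he hx ho hp hD1 _ => ?_, ?_⟩
    rotate_left
    · have hg : |V 0| ≤ t := hc V t ht 0
      have hz : |V 1| ≤ t := hc V t ht 1
      have hm : |V 2| ≤ t := hc V t ht 2
      have hg1 : |V 0| ≤ 1 := hg.trans ht1
      have hz1 : |V 1| ≤ 1 := hz.trans ht1
      have hm1 : |V 2| ≤ 1 := hm.trans ht1
      have he1 := he.trans (hGϑ ϑ hϑ1)
      have hx1 := hx.trans (hGϑ ϑ hϑ1)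
      have ho1 := ho.trans (hGϑ ϑ hϑ1)
      have hp1 := hp.trans (hGϑ ϑ hϑ1)
      have hmp := abs_muPlus_le_mul hg hm he1
      have hmp1 := abs_muPlus_le hg1 hm1 he1
      have hmpt := abs_phiPT_two_le hg hg1 hz1 hm hm1 hw0 hw1 he1 hx1 ho1 hp1 hmp hmp1
      have hmc := abs_Ttrans_two_le hm hm1 hw0
      have hzc := abs_Ttrans_one_le hz hm hm1 hw0 hs0
      exact abs_rhoPT_two_le hg hz hm hm1 hw0 hw1 hs0 he he1 hx ho hp hD1 hmp hmpt hmc hzc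
    · positivity
  refine ⟨P0 + P1 + P2 + 1, by positivity, fun s j V t ϑ ht ht1 hϑ0 hϑ1 hw0 hw1 hs0 hs1 hb hth he hx ho
    hp hD1 hD2 => ?_⟩
  have ht0 : 0 ≤ t := (norm_nonneg V).trans ht
  have hx3 : 0 ≤ ϑ * t ^ 3 := by positivity
  have r0 := h0 s j V t ϑ ht ht1 hϑ0 hϑ1 hw0 hw1 hs0 hs1 hb hth he hx ho hp hD1 hD2
  have r1 := h1 s j V t ϑ ht ht1 hϑ0 hϑ1 hw0 hw1 hs0 hs1 hb hth he hx ho hp hD1 hD2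
  have r2 := h2 s j V t ϑ ht ht1 hϑ0 hϑ1 hw0 hw1 hs0 hs1 hb hth he hx ho hp hD1 hD2
  have hsum : ∀ x : ℝ, (x ≤ P0 * ϑ * t ^ 3 ∨ x ≤ P1 * ϑ * t ^ 3 ∨ x ≤ P2 * ϑ * t ^ 3) →
      x ≤ (P0 + P1 + P2 + 1) * ϑ * t ^ 3 := by
    intro x hx'
    have e : (P0 + P1 + P2 + 1) * ϑ * t ^ 3 =
        P0 * (ϑ * t ^ 3) + P1 * (ϑ * t ^ 3) + P2 * (ϑ * t ^ 3) + ϑ * t ^ 3 := by ring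
    have h0' : 0 ≤ P0 * (ϑ * t ^ 3) := mul_nonneg hP0 hx3
    have h1' : 0 ≤ P1 * (ϑ * t ^ 3) := mul_nonneg hP1 hx3
    have h2' : 0 ≤ P2 * (ϑ * t ^ 3) := mul_nonneg hP2 hx3
    rw [e]
    rcases hx' with h | h | h <;> nlinarith [h]
  refine (pi_norm_le_iff_of_nonneg (by positivity)).2 fun i => ?_
  rw [Real.norm_eq_abs]
  fin_cases i
  · exact hsum _ (Or.inl r0)
  · exact hsum _ (Or.inr (Or.inl r1))
  · exact hsum _ (Or.inr (Or.inr r2))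

/-! ### `‖ρ̃_j(V)‖ ≤ Cϑ_j‖V‖³` for the explicit decomposition -/

/-- Combining an `m² ≥ 0` bound `|f| ≤ K₀Lⁿ` with an `m² > 0` bound `|f| ≤ KLⁿϑ` into
`|f| ≤ (K₀ + K)Lⁿϑ` for all `m² ≥ 0` (at `m² = 0`, `ϑ = 1`). [folklore] -/
theorem abs_le_decay_of_both {f K₀ K L s A ϑ : ℝ} (hK₀ : 0 ≤ K₀) (hK : 0 ≤ K) (hA : 0 ≤ A)
    (hs : 0 ≤ s) (hϑ0 : 0 ≤ ϑ) (hϑs : s = 0 → ϑ = 1) (h₀ : |f| ≤ K₀ * A) (h₁ : 0 < s → |f| ≤ K * A * ϑ)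
    (hle : (K₀ + K) * A ≤ L) : |f| ≤ L * ϑ := by
  rcases hs.lt_or_eq with hs' | hs'
  · calc |f| ≤ K * A * ϑ := h₁ hs'
      _ ≤ (K₀ + K) * A * ϑ := by
          refine mul_le_mul_of_nonneg_right ?_ hϑ0
          nlinarith [mul_nonneg hK₀ hA]
      _ ≤ L * ϑ := mul_le_mul_of_nonneg_right hle hϑ0
  · rw [hϑs hs'.symm, mul_one]
    calc |f| ≤ K₀ * A := h₀
      _ ≤ (K₀ + K) * A := by nlinarith [mul_nonneg hK hA]
      _ ≤ L := hle

/-- `ϑ_j(m²;p) ≤ 9^p(1+m²L^{2j})^{-p}` for `m² ∈ [0,1]`: the decay factor of this tree dominates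
the printed `(1+m²L^{2j})^{-k}` up to a constant. [cite: BauerschmidtBrydgesSlade2015LogCorr, §5.2 (scaling estimate, factor (1+m²L^{2(j-1)})^{-k}); [BBS-rg-pt] Proposition 4.2.1 (O((1+m²L^{2j})^{-k}|V|³))] -/
theorem decayFactor_le_printed (p : ℕ) {L : ℝ} (hL : 0 < L) {s : ℝ} (hs : 0 ≤ s) (hs1 : s ≤ 1)
    (j : ℕ) : ((1 + L ^ (2 * j) * s / (8 + s)) ^ p)⁻¹ ≤ 9 ^ p * ((1 + s * L ^ (2 * j)) ^ p)⁻¹ := by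
  have h8 : 0 < 8 + s := by linarith
  have hx : 0 ≤ L ^ (2 * j) * s := by positivity
  have h1 : L ^ (2 * j) * s ≤ 9 * (L ^ (2 * j) * s / (8 + s)) := by
    rw [mul_div_assoc', le_div_iff₀ h8]
    nlinarith
  have hkey : 1 + s * L ^ (2 * j) ≤ 9 * (1 + L ^ (2 * j) * s / (8 + s)) := by
    rw [mul_comm s]
    linarith
  have hA : 0 < 1 + L ^ (2 * j) * s / (8 + s) := by positivity
  rw [show (9 : ℝ) ^ p * ((1 + s * L ^ (2 * j)) ^ p)⁻¹ = (((1 + s * L ^ (2 * j)) / 9) ^ p)⁻¹ by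
    rw [div_pow, inv_div, div_eq_mul_inv]]
  refine inv_anti₀ (by positivity) (pow_le_pow_left₀ (by positivity) ?_ p)
  rw [div_le_iff₀ (by norm_num : (0 : ℝ) < 9)]
  linarith

set_option maxHeartbeats 800000 in
/-- **[BBS-rg-pt, Proposition 4.2.1], remainder estimate, for the explicit decomposition**: for
every `p` and `L ≥ 2` there is `C` such that for ALL `j ≥ 0`, ALL `m² ≥ 0` and all `V` with
`‖V‖ ≤ 1`, `‖ρ̃_j(V)‖ = ‖T_{j+1}(φ_{pt,j}^{(0)}(V)) - φ̄_j(T_j(V))‖ ≤ C·ϑ_j(m²;p)·‖V‖³`,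
`ϑ_j(m²;p) = ((1+L^{2j}m²/(8+m²))^p)⁻¹` — "the left-hand sides equal
`T_{j+1}(φ_pt(V)) + O((1+m²L^{2j})^{-k}|V|³)` and the right-hand sides `φ̄_j(T_j(V)) + O((1+m²L^{2j})^{-k}|V|³)`".
[cite: BauerschmidtBrydgesSlade2015LogCorr, §6.1 ("The composite maps T_{j+1} ∘ φ_{pt,j}^{(0)} ∘ T_j⁻¹ are equal, up to an error O(‖V‖³), to φ̄_j"); [BBS-rg-pt] Proposition 4.2.1 (ρ_{pt,j}(V) = O((1+m²L^{2j})^{-k}|V|³)) and §6.2] -/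
theorem norm_rhoPT_le (p : ℕ) {L : ℝ} (hL : 2 ≤ L) : ∃ C : ℝ, 0 < C ∧ ∀ s : ℝ, 0 ≤ s → ∀ j : ℕ,
    ∀ V : V3, ‖V‖ ≤ 1 → ‖rhoPT L s j V‖ ≤ C * ((1 + L ^ (2 * j) * s / (8 + s)) ^ p)⁻¹ * ‖V‖ ^ 3 := by
  have hL0 : (0 : ℝ) < L := by linarith
  have hL1 : (1 : ℝ) ≤ L := by linarith
  -- the `w̄`'s
  obtain ⟨W₁, hW₁, hw⟩ := abs_wbarOne_le
  obtain ⟨W₂, hW₂, hst⟩ := abs_wbarStar_le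
  -- the eight decaying quantities, for `m² ≥ 0` and with decay for `m² > 0`
  obtain ⟨Kb, hKb, hb⟩ := BBS2015_A1_bounded
  obtain ⟨Kb', hKb', hb'⟩ := abs_betaPT_le_decay p
  obtain ⟨Kt, hKt, hθ⟩ := abs_thetaPT_le
  obtain ⟨Kt', hKt', hθ'⟩ := abs_thetaPT_le_decay p
  obtain ⟨Ke, hKe, hη⟩ := abs_etaPT_le
  obtain ⟨Ke', hKe', hη'⟩ := abs_etaPT_le_decay p
  obtain ⟨Kx, hKx, hξ⟩ := abs_xiPT_le
  obtain ⟨Kx', hKx', hξ'⟩ := abs_xiPT_le_decay p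
  obtain ⟨Kp, hKp, hπ⟩ := abs_piPT_le
  obtain ⟨Kp', hKp', hπ'⟩ := abs_piPT_le_decay p
  obtain ⟨Kd, hKd, hD⟩ := abs_wbarOneDiff_le
  obtain ⟨Kd', hKd', hD'⟩ := abs_wbarOneDiff_le_decay p
  obtain ⟨Ks, hKs, hS⟩ := abs_wbarStarDiff_le
  obtain ⟨Ks', hKs', hS'⟩ := abs_wbarStarDiff_le_decay p
  set W : ℝ := W₁ * L ^ 4 + W₂ * L ^ 6 with hWdef
  set G : ℝ := (Kb + Kb') * L ^ 4 + (Kt + Kt') * L ^ 6 + (Ke + Ke') * L ^ 2 + (Kx + Kx') * L ^ 10 +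
    (Kp + Kp') * L ^ 6 + L ^ 2 * (1 / 4) * ((Kb + Kb') * L ^ 4) + (Kd + Kd') * L ^ 4 +
    (Ks + Ks') * L ^ 6 with hGdef
  have hW0 : 0 ≤ W := by positivity
  have hG0 : 0 ≤ G := by positivity
  obtain ⟨C, hC, hmain⟩ := exists_norm_rhoPT_le_of_bounds L hW0 hG0
  refine ⟨C, hC, fun s hs j V hV => ?_⟩
  set ϑ : ℝ := ((1 + L ^ (2 * j) * s / (8 + s)) ^ p)⁻¹ with hϑdef
  have hϑ0 : 0 ≤ ϑ := by positivity
  have hϑ1 : ϑ ≤ 1 := by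
    rw [hϑdef]
    refine inv_le_one_of_one_le₀ (one_le_pow₀ ?_)
    have : 0 ≤ L ^ (2 * j) * s / (8 + s) := by positivity
    linarith
  have hϑs : s = 0 → ϑ = 1 := fun h0 => by rw [hϑdef, h0]; simp
  -- nonnegativity of the partial sums of `G`
  have nb : 0 ≤ (Kb + Kb') * L ^ 4 := by positivity
  have nt : 0 ≤ (Kt + Kt') * L ^ 6 := by positivity
  have ne : 0 ≤ (Ke + Ke') * L ^ 2 := by positivity
  have nx : 0 ≤ (Kx + Kx') * L ^ 10 := by positivity
  have np : 0 ≤ (Kp + Kp') * L ^ 6 := by positivity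
  have no : 0 ≤ L ^ 2 * (1 / 4) * ((Kb + Kb') * L ^ 4) := by positivity
  have nd : 0 ≤ (Kd + Kd') * L ^ 4 := by positivity
  have ns : 0 ≤ (Ks + Ks') * L ^ 6 := by positivity
  have hw0 : |wbarOne 4 L s j| ≤ W := (hw L hL s hs j).trans (le_add_of_nonneg_right (by positivity))
  have hw1 : |wbarOne 4 L s (j + 1)| ≤ W :=
    (hw L hL s hs (j + 1)).trans (le_add_of_nonneg_right (by positivity))
  have hs0 : |wbarStar 4 L s j| ≤ W := (hst L hL s hs j).trans (le_add_of_nonneg_left (by positivity))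
  have hs1 : |wbarStar 4 L s (j + 1)| ≤ W :=
    (hst L hL s hs (j + 1)).trans (le_add_of_nonneg_left (by positivity))
  have gb : |betaPT 4 L s j| ≤ G * ϑ :=
    abs_le_decay_of_both hKb.le hKb'.le (by positivity) hs hϑ0 hϑs (hb L hL s hs j)
      (fun hs' => hb' L hL s hs' j) (by rw [hGdef]; linarith)
  have gt : |thetaPT 4 L s j| ≤ G * ϑ :=
    abs_le_decay_of_both hKt.le hKt'.le (by positivity) hs hϑ0 hϑs (hθ L hL s hs j)
      (fun hs' => hθ' L hL s hs' j) (by rw [hGdef]; linarith)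
  have ge : |etaPT 4 L s j| ≤ G * ϑ :=
    abs_le_decay_of_both hKe.le hKe'.le (by positivity) hs hϑ0 hϑs (hη L hL s hs j)
      (fun hs' => hη' L hL s hs' j) (by rw [hGdef]; linarith)
  have gx : |xiPT 4 L s j| ≤ G * ϑ :=
    abs_le_decay_of_both hKx.le hKx'.le (by positivity) hs hϑ0 hϑs (hξ L hL s hs j)
      (fun hs' => hξ' L hL s hs' j) (by rw [hGdef]; linarith)
  have gp : |piPT 4 L s j| ≤ G * ϑ :=
    abs_le_decay_of_both hKp.le hKp'.le (by positivity) hs hϑ0 hϑs (hπ L hL s hs j)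
      (fun hs' => hπ' L hL s hs' j) (by rw [hGdef]; linarith)
  have go : |omegaPT 4 L s j| ≤ G * ϑ := by
    have hω : ∀ s' : ℝ, |omegaPT 4 L s' j| = L ^ 2 * (1 / 4) * |betaPT 4 L s' j| := fun s' => by
      unfold omegaPT
      rw [abs_mul, abs_of_nonneg (by positivity : (0 : ℝ) ≤ L ^ 2 * (1 / 4))]
    have h₀ : |omegaPT 4 L s j| ≤ L ^ 2 * (1 / 4) * Kb * L ^ 4 := by
      rw [hω]
      calc L ^ 2 * (1 / 4) * |betaPT 4 L s j| ≤ L ^ 2 * (1 / 4) * (Kb * L ^ 4) :=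
            mul_le_mul_of_nonneg_left (hb L hL s hs j) (by positivity)
        _ = L ^ 2 * (1 / 4) * Kb * L ^ 4 := by ring
    have h₁ : 0 < s → |omegaPT 4 L s j| ≤ L ^ 2 * (1 / 4) * Kb' * L ^ 4 * ϑ := fun hs' => by
      rw [hω]
      calc L ^ 2 * (1 / 4) * |betaPT 4 L s j| ≤ L ^ 2 * (1 / 4) * (Kb' * L ^ 4 * ϑ) :=
            mul_le_mul_of_nonneg_left (hb' L hL s hs' j) (by positivity)
        _ = L ^ 2 * (1 / 4) * Kb' * L ^ 4 * ϑ := by ring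
    refine abs_le_decay_of_both (K₀ := L ^ 2 * (1 / 4) * Kb) (K := L ^ 2 * (1 / 4) * Kb') (A := L ^ 4)
      (by positivity) (by positivity) (by positivity) hs hϑ0 hϑs h₀ h₁ ?_
    rw [hGdef]
    linarith
  have gd : |wbarOneDiff 4 L s j| ≤ G * ϑ :=
    abs_le_decay_of_both hKd.le hKd'.le (by positivity) hs hϑ0 hϑs (hD L hL s hs j)
      (fun hs' => hD' L hL s hs' j) (by rw [hGdef]; linarith)
  have gs : |wbarStarDiff 4 L s j| ≤ G * ϑ :=
    abs_le_decay_of_both hKs.le hKs'.le (by positivity) hs hϑ0 hϑs (hS L hL s hs j)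
      (fun hs' => hS' L hL s hs' j) (by rw [hGdef]; linarith)
  exact hmain s j V ‖V‖ ϑ le_rfl hV hϑ0 hϑ1 hw0 hw1 hs0 hs1 gb gt ge gx go gp gd gs

/-! ### The inverse of `T_j` on a ball independent of `j` and `m²` -/

/-- **Lipschitz bound of the quadratic part of `T_j`**: if `|w̄_j^{(1)}|, |w̄_j^{(**)}| ≤ W` and
`‖V‖, ‖V'‖ ≤ r`, then `‖(T_j(V) - V) - (T_j(V') - V')‖ ≤ 8Wr‖V - V'‖`.
[cite: BauerschmidtBrydgesSlade2015LogCorr, §6.1 ("Since the T_j are polynomials, this implies that they are invertible in a neighbourhood of 0 that is independent of j")] -/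
theorem norm_Ttrans_sub_sub_le {L s : ℝ} {j : ℕ} {W r : ℝ} (hw : |wbarOne 4 L s j| ≤ W)
    (hst : |wbarStar 4 L s j| ≤ W) {V V' : V3} (hV : ‖V‖ ≤ r) (hV' : ‖V'‖ ≤ r) :
    ‖(Ttrans L s j V - V) - (Ttrans L s j V' - V')‖ ≤ 8 * W * r * ‖V - V'‖ := by
  have hW : 0 ≤ W := (abs_nonneg _).trans hw
  have hr : 0 ≤ r := (norm_nonneg _).trans hV
  set δ : ℝ := ‖V - V'‖ with hδ
  have hδ0 : 0 ≤ δ := norm_nonneg _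
  have hc : ∀ (U : V3) (u : ℝ), ‖U‖ ≤ u → ∀ i, |U i| ≤ u := fun U u hu i =>
    le_trans (by rw [← Real.norm_eq_abs]; exact norm_le_pi_norm U i) hu
  have hd : ∀ i, |V i - V' i| ≤ δ := fun i => by
    have := hc (V - V') δ le_rfl i; simpa using this
  have h0 := hc V r hV 0; have h1 := hc V r hV 1; have h2 := hc V r hV 2
  have h0' := hc V' r hV' 0; have h1' := hc V' r hV' 1; have h2' := hc V' r hV' 2
  have d0 := hd 0; have d1 := hd 1; have d2 := hd 2
  refine (pi_norm_le_iff_of_nonneg (by positivity)).2 fun i => ?_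
  rw [Real.norm_eq_abs]
  fin_cases i
  · simp only [Fin.zero_eta, Pi.sub_apply, Ttrans_apply_zero]
    have e : V 0 + 4 * V 0 * V 2 * wbarOne 4 L s j - V 0 - (V' 0 + 4 * V' 0 * V' 2 * wbarOne 4 L s j - V' 0)
        = 4 * wbarOne 4 L s j * (V 0 * (V 2 - V' 2) + (V 0 - V' 0) * V' 2) := by ring
    rw [e, abs_mul, abs_mul, show |(4 : ℝ)| = 4 by norm_num]
    have hin : |V 0 * (V 2 - V' 2) + (V 0 - V' 0) * V' 2| ≤ r * δ + δ * r :=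
      abs_add_le_of_le (abs_mul_le_of_le h0 d2) (abs_mul_le_of_le d0 h2')
    calc 4 * |wbarOne 4 L s j| * |V 0 * (V 2 - V' 2) + (V 0 - V' 0) * V' 2| ≤ 4 * W * (r * δ + δ * r) := by
          gcongr
      _ = 8 * W * r * δ := by ring
  · simp only [Fin.mk_one, Pi.sub_apply, Ttrans_apply_one]
    have e : V 1 + 2 * V 1 * V 2 * wbarOne 4 L s j + 1 / 2 * V 2 ^ 2 * wbarStar 4 L s j - V 1 -
        (V' 1 + 2 * V' 1 * V' 2 * wbarOne 4 L s j + 1 / 2 * V' 2 ^ 2 * wbarStar 4 L s j - V' 1)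
        = 2 * wbarOne 4 L s j * (V 1 * (V 2 - V' 2) + (V 1 - V' 1) * V' 2) +
          1 / 2 * wbarStar 4 L s j * ((V 2 - V' 2) * (V 2 + V' 2)) := by ring
    rw [e]
    have hin1 : |V 1 * (V 2 - V' 2) + (V 1 - V' 1) * V' 2| ≤ r * δ + δ * r :=
      abs_add_le_of_le (abs_mul_le_of_le h1 d2) (abs_mul_le_of_le d1 h2')
    have hin2 : |(V 2 - V' 2) * (V 2 + V' 2)| ≤ δ * (r + r) :=
      abs_mul_le_of_le d2 (abs_add_le_of_le h2 h2')
    have h2abs : |(2 : ℝ)| ≤ 2 := by norm_num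
    have hhalf : |(1 / 2 : ℝ)| ≤ 1 / 2 := by norm_num
    calc |2 * wbarOne 4 L s j * (V 1 * (V 2 - V' 2) + (V 1 - V' 1) * V' 2) +
          1 / 2 * wbarStar 4 L s j * ((V 2 - V' 2) * (V 2 + V' 2))|
        ≤ 2 * W * (r * δ + δ * r) + 1 / 2 * W * (δ * (r + r)) :=
          abs_add_le_of_le (abs_mul_le_of_le (abs_mul_le_of_le h2abs hw) hin1)
            (abs_mul_le_of_le (abs_mul_le_of_le hhalf hst) hin2)
      _ = 5 * W * r * δ := by ring
      _ ≤ 8 * W * r * δ := by nlinarith [mul_nonneg (mul_nonneg hW hr) hδ0]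
  · simp only [Fin.reduceFinMk, Pi.sub_apply, Ttrans_apply_two]
    have e : V 2 + V 2 ^ 2 * wbarOne 4 L s j - V 2 - (V' 2 + V' 2 ^ 2 * wbarOne 4 L s j - V' 2)
        = wbarOne 4 L s j * ((V 2 - V' 2) * (V 2 + V' 2)) := by ring
    rw [e]
    have hin2 : |(V 2 - V' 2) * (V 2 + V' 2)| ≤ δ * (r + r) :=
      abs_mul_le_of_le d2 (abs_add_le_of_le h2 h2')
    calc |wbarOne 4 L s j * ((V 2 - V' 2) * (V 2 + V' 2))| ≤ W * (δ * (r + r)) := abs_mul_le_of_le hw hin2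
      _ = 2 * W * r * δ := by ring
      _ ≤ 8 * W * r * δ := by nlinarith [mul_nonneg (mul_nonneg hW hr) hδ0]

/-- **`T_j` is invertible on a ball independent of `j` and `m²`, with `T_j⁻¹(U) = U + O(‖U‖²)`**:
if `|w̄_j^{(1)}|, |w̄_j^{(**)}| ≤ W` (`W ≥ 1`) and `‖U‖ ≤ 1/(32W)`, there is a unique `V` with
`‖V‖ ≤ 1/(16W)` and `T_j(V) = U`; it satisfies `‖V - U‖ ≤ 4W‖V‖² ≤ 8W‖U‖²` (contraction principle
for `V ↦ U - (T_j(V) - V)` on the closed ball of radius `1/(16W)`, Lipschitz constant `½`).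
[cite: BauerschmidtBrydgesSlade2015LogCorr, §6.1 ("invertible in a neighbourhood of 0 that is independent of j"); [BBS-rg-pt] Proposition 4.2.1 ("the inverse T_j⁻¹ to T_j exists on B … with T_j⁻¹(V) = V + O(|V|²)") and §6.2] -/
theorem Ttrans_inverse {L s : ℝ} {j : ℕ} {W : ℝ} (hW1 : 1 ≤ W) (hw : |wbarOne 4 L s j| ≤ W)
    (hst : |wbarStar 4 L s j| ≤ W) (U : V3) (hU : ‖U‖ ≤ 1 / (32 * W)) :
    ∃ V : V3, ‖V‖ ≤ 1 / (16 * W) ∧ Ttrans L s j V = U ∧ ‖V - U‖ ≤ 8 * W * ‖U‖ ^ 2 ∧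
      ∀ V' : V3, ‖V'‖ ≤ 1 / (16 * W) → Ttrans L s j V' = U → V' = V := by
  have hW : 0 < W := by linarith
  set r : ℝ := 1 / (16 * W) with hr
  have hr0 : 0 < r := by positivity
  have hWr : W * r = 1 / 16 := by rw [hr]; field_simp
  have hr2 : r / 2 = 1 / (32 * W) := by rw [hr]; ring
  have hU' : ‖U‖ ≤ r / 2 := by rw [hr2]; exact hU
  -- the map `Φ(V) = U - (T V - V)` on the closed ball of radius `r`
  have hmaps : ∀ V : V3, ‖V‖ ≤ r → ‖U - (Ttrans L s j V - V)‖ ≤ r := by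
    intro V hV
    have hq := norm_Ttrans_sub_self_le hw hst V
    calc ‖U - (Ttrans L s j V - V)‖ ≤ ‖U‖ + ‖Ttrans L s j V - V‖ := norm_sub_le _ _
      _ ≤ r / 2 + 4 * W * ‖V‖ ^ 2 := add_le_add hU' hq
      _ ≤ r / 2 + 4 * W * r ^ 2 := by gcongr
      _ = r / 2 + 4 * (W * r) * r := by ring
      _ ≤ r := by rw [hWr]; linarith
  have hlip : ∀ V V' : V3, ‖V‖ ≤ r → ‖V'‖ ≤ r →
      ‖(U - (Ttrans L s j V - V)) - (U - (Ttrans L s j V' - V'))‖ ≤ 1 / 2 * ‖V - V'‖ := by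
    intro V V' hV hV'
    have h := norm_Ttrans_sub_sub_le hw hst hV hV'
    calc ‖(U - (Ttrans L s j V - V)) - (U - (Ttrans L s j V' - V'))‖
        = ‖(Ttrans L s j V - V) - (Ttrans L s j V' - V')‖ := by
          rw [← norm_neg]; congr 1; abel
      _ ≤ 8 * W * r * ‖V - V'‖ := h
      _ = 1 / 2 * ‖V - V'‖ := by rw [mul_assoc 8, hWr]; ring
  -- Banach fixed point on the complete subtype `closedBall 0 r`
  set S : Set V3 := closedBall (0 : V3) r with hS
  have hmem : ∀ {V : V3}, V ∈ S ↔ ‖V‖ ≤ r := fun {V} => by rw [hS, mem_closedBall, dist_zero_right]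
  have hcl : IsClosed S := isClosed_closedBall
  haveI : CompleteSpace S := hcl.isComplete.completeSpace_coe
  haveI : Nonempty S := ⟨⟨0, hmem.2 (by simp [hr0.le])⟩⟩
  let Φ : S → S := fun V => ⟨U - (Ttrans L s j V - V), hmem.2 (hmaps V (hmem.1 V.2))⟩
  have hΦ : ContractingWith (1 / 2 : ℝ≥0) Φ := by
    refine ⟨by norm_num, LipschitzWith.of_dist_le_mul fun V V' => ?_⟩
    rw [Subtype.dist_eq, Subtype.dist_eq, dist_eq_norm, dist_eq_norm]
    push_cast
    exact hlip V V' (hmem.1 V.2) (hmem.1 V'.2)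
  obtain ⟨Vs, hVs⟩ : ∃ Vs : S, Φ Vs = Vs := ⟨ContractingWith.fixedPoint Φ hΦ, hΦ.fixedPoint_isFixedPt⟩
  have hV : ‖(Vs : V3)‖ ≤ r := hmem.1 Vs.2
  have hfix : U - (Ttrans L s j Vs - Vs) = Vs := congrArg Subtype.val hVs
  have hT : Ttrans L s j Vs = U := by linear_combination -hfix
  refine ⟨Vs, hV, hT, ?_, fun V' hV' hT' => ?_⟩
  · -- `‖V - U‖ = ‖T V - V‖ ≤ 4W‖V‖²` and `‖V‖ ≤ ‖U‖ + ¼‖V‖`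
    have hq := norm_Ttrans_sub_self_le hw hst (Vs : V3)
    rw [hT] at hq
    have hVU : ‖(Vs : V3) - U‖ ≤ 4 * W * ‖(Vs : V3)‖ ^ 2 := by rw [← norm_neg, neg_sub]; exact hq
    have hVle : ‖(Vs : V3)‖ ≤ ‖U‖ + 4 * W * ‖(Vs : V3)‖ ^ 2 := by
      calc ‖(Vs : V3)‖ = ‖U + ((Vs : V3) - U)‖ := by congr 1; abel
        _ ≤ ‖U‖ + ‖(Vs : V3) - U‖ := norm_add_le _ _
        _ ≤ ‖U‖ + 4 * W * ‖(Vs : V3)‖ ^ 2 := add_le_add le_rfl hVU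
    have hq4 : 4 * W * ‖(Vs : V3)‖ ^ 2 ≤ 1 / 4 * ‖(Vs : V3)‖ := by
      calc 4 * W * ‖(Vs : V3)‖ ^ 2 = 4 * (W * ‖(Vs : V3)‖) * ‖(Vs : V3)‖ := by ring
        _ ≤ 4 * (W * r) * ‖(Vs : V3)‖ := by gcongr
        _ = 1 / 4 * ‖(Vs : V3)‖ := by rw [hWr]; ring
    have hV43 : ‖(Vs : V3)‖ ≤ 4 / 3 * ‖U‖ := by linarith
    calc ‖(Vs : V3) - U‖ ≤ 4 * W * ‖(Vs : V3)‖ ^ 2 := hVU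
      _ ≤ 4 * W * (4 / 3 * ‖U‖) ^ 2 := by gcongr
      _ = (64 / 9) * W * ‖U‖ ^ 2 := by ring
      _ ≤ 8 * W * ‖U‖ ^ 2 := by nlinarith [mul_nonneg hW.le (sq_nonneg ‖U‖)]
  · -- uniqueness: `V'` is another fixed point of the contraction
    have hfix' : Φ ⟨V', hmem.2 hV'⟩ = ⟨V', hmem.2 hV'⟩ := by
      apply Subtype.ext
      show U - (Ttrans L s j V' - V') = V'
      rw [hT']; abel
    have h1 := hΦ.fixedPoint_unique hfix'
    have h2 := hΦ.fixedPoint_unique hVs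
    have : (⟨V', hmem.2 hV'⟩ : S) = Vs := h1.trans h2.symm
    exact congrArg Subtype.val this

/-- **BBS 2015, §6.1: the `T_j` "are invertible in a neighbourhood of `0` that is independent of
`j`"** (and of `m² ≥ 0`), with `T_j⁻¹(U) = U + O(‖U‖²)` uniformly, for the explicit decomposition in
`d = 4`, `L ≥ 2`: there are `r > 0` and `A` such that for every `m² ≥ 0`, `j` and `‖U‖ ≤ r` there is a
unique `V` with `‖V‖ ≤ 2r` and `T_j(V) = U`, and `‖V - U‖ ≤ A‖U‖²`.
[cite: BauerschmidtBrydgesSlade2015LogCorr, §6.1 (display T_j(V) = V + O(‖V‖²) and the sentence following it); [BBS-rg-pt] Proposition 4.2.1] -/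
theorem exists_Ttrans_inverse {L : ℝ} (hL : 2 ≤ L) : ∃ r A : ℝ, 0 < r ∧ 0 < A ∧ ∀ s : ℝ, 0 ≤ s →
    ∀ j : ℕ, ∀ U : V3, ‖U‖ ≤ r → ∃ V : V3, ‖V‖ ≤ 2 * r ∧ Ttrans L s j V = U ∧ ‖V - U‖ ≤ A * ‖U‖ ^ 2 ∧
      ∀ V' : V3, ‖V'‖ ≤ 2 * r → Ttrans L s j V' = U → V' = V := by
  obtain ⟨W₁, hW₁, hw⟩ := abs_wbarOne_le
  obtain ⟨W₂, hW₂, hst⟩ := abs_wbarStar_le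
  have hL1 : (1 : ℝ) ≤ L := by linarith
  set W : ℝ := W₁ * L ^ 4 + W₂ * L ^ 6 + 1 with hWdef
  have hW1 : 1 ≤ W := by
    rw [hWdef]
    exact le_add_of_nonneg_left (by positivity)
  have hW0 : 0 < W := by linarith
  refine ⟨1 / (32 * W), 8 * W, by positivity, by positivity, fun s hs j U hU => ?_⟩
  have hw' : |wbarOne 4 L s j| ≤ W := by
    refine (hw L hL s hs j).trans ?_
    rw [hWdef]
    have h6 : (0 : ℝ) ≤ W₂ * L ^ 6 := by positivity
    linarith
  have hst' : |wbarStar 4 L s j| ≤ W := by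
    refine (hst L hL s hs j).trans ?_
    rw [hWdef]
    have h4 : (0 : ℝ) ≤ W₁ * L ^ 4 := by positivity
    linarith
  have e2r : 2 * (1 / (32 * W)) = 1 / (16 * W) := by field_simp; ring
  obtain ⟨V, hV, hT, hVU, huniq⟩ := Ttrans_inverse hW1 hw' hst' U hU
  exact ⟨V, by rwa [e2r], hT, hVU, fun V' hV' hT' => huniq V' (by rwa [e2r] at hV') hT'⟩

/-- **[BBS-rg-pt, Proposition 4.2.1] / BBS 2015, §6.1, assembled for the explicit decomposition**
(`d = 4`, `L ≥ 2`, every `p`): there are `r > 0` and `C` such that for every `m² ≥ 0`, every `j` and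
every `U` with `‖U‖ ≤ r`, writing `V = T_j⁻¹(U)` (the unique preimage with `‖V‖ ≤ 2r`):
`T_{j+1}(φ_{pt,j}^{(0)}(V)) = φ̄_j(U) + ρ̃_j(V)` with `‖ρ̃_j(V)‖ ≤ C·ϑ_j(m²;p)·‖U‖³` and
`‖V - U‖ ≤ C‖U‖²` — i.e. `T_{j+1} ∘ φ_pt^{(0)} ∘ T_j⁻¹ = φ̄_j + ρ_{pt,j}`, `ρ_{pt,j} = ρ̃_j ∘ T_j⁻¹ =
O(ϑ_j‖U‖³)`, on a ball independent of `j` and `m²`.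
[cite: BauerschmidtBrydgesSlade2015LogCorr, §6.1 ("The composite maps T_{j+1} ∘ φ_{pt,j}^{(0)} ∘ T_j⁻¹ are equal, up to an error O(‖V‖³), to φ̄_j"); [BBS-rg-pt] Proposition 4.2.1, (Tcomp)] -/
theorem BBSrgpt_prop421 (p : ℕ) {L : ℝ} (hL : 2 ≤ L) : ∃ r C : ℝ, 0 < r ∧ 0 < C ∧ ∀ s : ℝ, 0 ≤ s →
    ∀ j : ℕ, ∀ U : V3, ‖U‖ ≤ r → ∃ V : V3, ‖V‖ ≤ 2 * r ∧ Ttrans L s j V = U ∧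
      (∀ V' : V3, ‖V'‖ ≤ 2 * r → Ttrans L s j V' = U → V' = V) ∧ ‖V - U‖ ≤ C * ‖U‖ ^ 2 ∧
      Ttrans L s (j + 1) (phiPT L s j V) = (wsawQuadFlow L s).map j U + rhoPT L s j V ∧
      ‖rhoPT L s j V‖ ≤ C * ((1 + L ^ (2 * j) * s / (8 + s)) ^ p)⁻¹ * ‖U‖ ^ 3 := by
  obtain ⟨r, A, hr, hA, hinv⟩ := exists_Ttrans_inverse hL
  obtain ⟨C, hC, hρ⟩ := norm_rhoPT_le p hL
  -- shrink the ball so that `‖V‖ ≤ 2r' ≤ 1` and `‖V‖ ≤ 2‖U‖`-type control: use `‖V‖ ≤ ‖U‖ + A‖U‖²`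
  set r' : ℝ := min r (min (1 / 4) (1 / (4 * A))) with hr'
  have hr'0 : 0 < r' := lt_min hr (lt_min (by norm_num) (by positivity))
  have hr'r : r' ≤ r := min_le_left _ _
  have hr'1 : r' ≤ 1 / 4 := (min_le_right _ _).trans (min_le_left _ _)
  have hr'A : r' ≤ 1 / (4 * A) := (min_le_right _ _).trans (min_le_right _ _)
  refine ⟨r', 8 * C + A, hr'0, by positivity, fun s hs j U hU => ?_⟩
  obtain ⟨V, hV, hT, hVU, huniq⟩ := hinv s hs j U (hU.trans hr'r)
  -- `‖V‖ ≤ ‖U‖ + A‖U‖² ≤ 2‖U‖ ≤ 2r' ≤ 1`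
  have hU0 : 0 ≤ ‖U‖ := norm_nonneg _
  have hAU : A * ‖U‖ ≤ 1 / 4 := by
    calc A * ‖U‖ ≤ A * r' := by gcongr
      _ ≤ A * (1 / (4 * A)) := by gcongr
      _ = 1 / 4 := by field_simp
  have hVle : ‖V‖ ≤ 2 * ‖U‖ := by
    calc ‖V‖ = ‖U + (V - U)‖ := by congr 1; abel
      _ ≤ ‖U‖ + ‖V - U‖ := norm_add_le _ _
      _ ≤ ‖U‖ + A * ‖U‖ ^ 2 := add_le_add le_rfl hVU
      _ = ‖U‖ + (A * ‖U‖) * ‖U‖ := by ring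
      _ ≤ ‖U‖ + 1 / 4 * ‖U‖ := by gcongr
      _ ≤ 2 * ‖U‖ := by linarith
  have hV2r : ‖V‖ ≤ 2 * r' := hVle.trans (by linarith)
  have hV1 : ‖V‖ ≤ 1 := hV2r.trans (by linarith)
  have hρV := hρ s hs j V hV1
  refine ⟨V, hV2r, hT, fun V' hV' hT' => huniq V' (hV'.trans (by linarith)) hT', ?_, ?_, ?_⟩
  · exact hVU.trans (by nlinarith [mul_nonneg hC.le (sq_nonneg ‖U‖)])
  · rw [rhoPT, hT]; abel
  · calc ‖rhoPT L s j V‖ ≤ C * ((1 + L ^ (2 * j) * s / (8 + s)) ^ p)⁻¹ * ‖V‖ ^ 3 := hρV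
      _ ≤ C * ((1 + L ^ (2 * j) * s / (8 + s)) ^ p)⁻¹ * (2 * ‖U‖) ^ 3 := by gcongr
      _ = 8 * C * ((1 + L ^ (2 * j) * s / (8 + s)) ^ p)⁻¹ * ‖U‖ ^ 3 := by ring
      _ ≤ (8 * C + A) * ((1 + L ^ (2 * j) * s / (8 + s)) ^ p)⁻¹ * ‖U‖ ^ 3 := by
          have : 0 ≤ ((1 + L ^ (2 * j) * s / (8 + s)) ^ p)⁻¹ * ‖U‖ ^ 3 := by positivity
          nlinarith

end CTWSAW

end Literature.Barriers.CriticalPhenomena
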